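/-
Copyright: the b2b-balaban T⁴-continuum CRUX team, row NE7b, leaf lineage `t4-ne7b-formalise-leaf-02` (gen 133). Project licence.
-/
import Summits.QuantumFields.BalabanUV.T4Continuum.Spine.NE7b.OneStepAveragePeriodicity
import Summits.QuantumFields.BalabanUV.T4Continuum.Spine.NE7b.AveragedCurlFormSplit
import Literature.MathematicalPhysics.QuantumFieldTheory.Balaban1983to89.B7Prop3GeneralLinearBound
import Literature.MathematicalPhysics.QuantumFieldTheory.Balaban1983to89.B8Ineq132

/-!
# THE COVARIANT COARSE CURL vs THE FLAT ONE, AND ITS GAUGE COVARIANCE — Lemma 5.5's two letters at ONE step on the two-scale torus: for a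
# torus coarse 1-form `B` and the transports `V̄₀` at the base points, (ℓ1) `|X_P(B) − X¹_P(B)| ≤ 8τ·Σ_{c ∈ ∂P} ‖B(c)‖` when the four coarse bonds of `P`
# carry `‖V̄₀(c) − 1‖ ≤ τ`, hence `Σ_P (X_P(B) − X¹_P(B))² ≤ (8τ)²·4·2(d−1)·Σ_c ‖B(c)‖²`; (cov)∕(iso) `X^{V₀^g}_P(Ad_g B) = X^{V₀}_P(B)` for an `LM`-periodic
# gauge function `g` with values in the unit-ball class
# (row NE7b, node U5c; `HOME/b2b-balaban-r1/SectE-interface-proof.md` §5.5, Lemma 5.5: «summand-wise gauge covariance … `(∂_{V^u}B′^u)(P) = Ad(u(y_P))(∂_VB′)(P)` …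
# and directly `|((∂_{e^{iW}} − ∂_1)B″)(P)| ≤ 4·2ε_F max_{c∈∂P}|B″(c)|`»; E-side key reading — the (h2) skeleton's displayed letters `η = 8ε_F` (`…SqrtFormPerturbationLetters`)
# and (cov)∕(iso) (`…AdmissibleFloorIMS`) BY VALUE at `k = 1` in the torus currency of `…OneStepCurlFormDisplay`)

Cell `pub-balaban`, sub-cell `t4`, spine estimate NE7b (`T4WeightBudget.RelWeightBound`; the cell's OWN estimate — NOT PRINTED in
[Bałaban 1983–89], NOT PROVED).  Crux-route work under `Spine/NE7b/` by the row's E-side ∕ key-readings ∕ lattice-geometry leaf lineage; [folklore]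
letters BY NAME over `B7Prop1Explicit.bavg_gaugeAct` ((11) at one step), `B7Prop3GeneralLinearBound.norm_conjR_sub_self_le` (`‖R(u)Z − Z‖ ≤ 2‖u − 1‖‖Z‖`),
`B8Ineq132.norm_conjR` (`‖R(g)Z‖ = ‖Z‖` on `U1`), this lineage's `…OneStepAveragePeriodicity.apply_qb_add_single` (the wrap lemma, for the gauge function), leaf-05's
`…SqrtFormPerturbationLetters.pert_letter_of_local` and the torus counts `…AveragedCurlFormSplit.card_image_four_le` ∕ `…TorusPlaquetteIncidence`; NOTHING of
Bałaban's is asserted beyond what those modules prove; no `T4Continuum/Support` leaf typed; no `def`, no notation, no instance — the covariant coarse curl `X`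
(hypothesis `hX`, VERBATIM as in `…OneStepCurlFormDisplay`), its flat twin `X¹` (`hX1`) and its gauge transform `X'` (`hX'`, transports `\overline{(V₀^g)}`) are
characterised by hypotheses; zero `sorry`.

WHAT IS PROVED ([folklore]):
* §1 sizes of the transports: (private `norm_mul_sub_one_le`: `‖uv − 1‖ ≤ ‖u − 1‖ + ‖v − 1‖` in `U1`), `norm_w2_sub_one_le` ∕ `norm_w3_sub_one_le` (the composite
  transports `u₁u₂u₃⁻¹`, `u₁u₂u₃⁻¹u₄⁻¹` are within `3τ`, `4τ` of `1`); the isometry `‖R(g)Z‖ = ‖Z‖` for `g ∈ U1` is `B8Ineq132.norm_conjR` BY NAME.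
* §2 **`abs_X_sub_X1_le`** — (ℓ1) AT ONE PLAQUETTE: `|X_P(B) − X¹_P(B)| ≤ 2τ‖B₂‖ + 6τ‖B₃‖ + 8τ‖B₄‖ ≤ 8τ·Σ_{c ∈ bonds(P)} ‖B(c)‖` (`1 < M`);
  **`sum_sq_X_sub_X1_le`** — SUMMED: `Σ_P (X_P(B) − X¹_P(B))² ≤ (8τ)²·4·2(d−1)·Σ_c ‖B(c)‖²` (`pert_letter_of_local` BY NAME with `η := 8τ`, `a = 4`, `b = 2(d−1)`)
  — the (h2) skeleton's `hfg` letter at `k = 1` with the transports' size `τ` DISPLAYED.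
* §3 **`X_gaugeAct_eq`** — (cov)∕(iso): for `g : ℤ^d → 𝔸ˣ` unit-ball valued and `LM`-periodic, block loops of `V₀` within `1` of `1` (`hW1`; e.g. under (44) +
  `512(d+1)(d+4)L²α₀ ≤ 1`, `Wcx_sub_one_lt_one`): `X'_P((y,ν) ↦ R(g(qb y))B(y,ν)) = X_P(B)`, where `X'` is the curl functional with the transports of
  `V₀^g = gaugeAct g V₀` — every term is conjugated by `g(qb y)` (`bavg_gaugeAct` + the wrap lemma for `g`), and `R(g(qb y))` is an isometry (`B8Ineq132.norm_conjR`); core form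
  `X_gaugeAct_eq_of_eq`; **`X_gaugeAct_eq_of_noWrap`** — the same at an INTERIOR plaquette (`y_κ + 1 < M`, `y_μ + 1 < M`) for ANY `g` (a local gauge on a
  cube off the seam, e.g. the axial gauge of reading R-V; `qb_add_single_of_noWrap`).

HONEST SHAPE.  `τ` is NOT discharged here: globally `‖V̄₀(c) − 1‖` is not small; the memo's reading R-V supplies, on every `M`-cube, a gauge `g` with
`‖\overline{(V₀^g)}(c) − 1‖ ≤ ε_F` — which is exactly why §3 accompanies §2 (the (h2) skeleton localises by IMS, transforms each piece to its small gauge by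
(cov)∕(iso), and pays (ℓ1) there).  NOT HERE: the local small gauges (R-V; [B9] (3.35)–(3.36), [B7] Props 1–2), the IMS error, Lemma 2.4′ (the (h2) floor —
leaf-05's `…AdmissibleFloorIMS ∕ …AdmissibleFloorLetters`), `k > 1`, anything of Bałaban's ((A3) ∕ (A1c), NC-NE7b-α UNRULED).  BY-NAME EFFECT ON THE WALL: NONE
(the (h2) slot's letters at `k = 1`; the wall is (R2)).  NE7b NOT PRINTED ∕ NOT PROVED; spine PROVED 0∕9; rung (B)+1 on a FINITE torus — NOT infinite volume,
NOT the mass gap, NOT Clay.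
HONEST DEPENDENCY: continuum YM on T⁴ ⇐ BetaPertH ∧ nine spine estimates (0/9 proved); BetaPertH ⇐ (D1) ∧ (D4) ∧ CAP+tail; G-an2-4 gates
asym, D1 and NE2/3/4.
-/

set_option autoImplicit false

noncomputable section

open scoped BigOperators
open Finset Matrix
open Literature.MathematicalPhysics.QuantumFieldTheory.Balaban1983to89
open Literature.MathematicalPhysics.QuantumFieldTheory.Balaban1983to89.B7Prop1Explicit (Site e hol boxVec bavg plaqWord U1 Wcx gaugeAct
  bavg_gaugeAct norm_inv_sub_one_le mem_U1)
open Literature.MathematicalPhysics.QuantumFieldTheory.Balaban1983to89.B7Eq78Linearization (conjR conjR_add conjR_sub conjR_apply)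
open Literature.MathematicalPhysics.QuantumFieldTheory.Balaban1983to89.B7Prop3GeneralRotated (conjR_mul_left norm_conjR_le)
open Literature.MathematicalPhysics.QuantumFieldTheory.Balaban1983to89.B7Prop3GeneralLinearBound (norm_conjR_sub_self_le)
open Literature.MathematicalPhysics.QuantumFieldTheory.Balaban1983to89.T4TermwiseTorus (IsPeriodic)

namespace Summit.QuantumFields.BalabanUV.T4Continuum.NE7b.CoarseCurlTransportLetters

variable {d : ℕ}
variable {𝔸 : Type*} [NormedRing 𝔸] [NormedAlgebra ℂ 𝔸] [NormOneClass 𝔸] [CompleteSpace 𝔸]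

/-! ## §1 Sizes of the transports -/

section Sizes

omit [NormedAlgebra ℂ 𝔸] [CompleteSpace 𝔸] in
/-- `‖uv − 1‖ ≤ ‖u − 1‖ + ‖v − 1‖` for `u` in the unit-ball class (`uv − 1 = u(v − 1) + (u − 1)`); `private` — the public copy is
`…LocalGaugeTransportSize.norm_mul_sub_one_le`. [folklore] -/
private theorem norm_mul_sub_one_le {u : 𝔸ˣ} (hu : u ∈ U1 𝔸) (v : 𝔸ˣ) :
    ‖((u * v : 𝔸ˣ) : 𝔸) - 1‖ ≤ ‖(u : 𝔸) - 1‖ + ‖(v : 𝔸) - 1‖ := by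
  have h1 := (mem_U1.1 hu).1
  have hsplit : ((u * v : 𝔸ˣ) : 𝔸) - 1 = (u : 𝔸) * ((v : 𝔸) - 1) + ((u : 𝔸) - 1) := by
    rw [Units.val_mul]; noncomm_ring
  rw [hsplit]
  refine (norm_add_le _ _).trans ?_
  have h2 : ‖(u : 𝔸) * ((v : 𝔸) - 1)‖ ≤ ‖(v : 𝔸) - 1‖ :=
    (norm_mul_le _ _).trans (by nlinarith [norm_nonneg ((v : 𝔸) - 1)])
  linarith

omit [NormedAlgebra ℂ 𝔸] [CompleteSpace 𝔸] in
/-- the composite transport `u₁u₂u₃⁻¹` is within `3τ` of `1`. [folklore] -/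
theorem norm_w2_sub_one_le {u₁ u₂ u₃ : 𝔸ˣ} (h₁ : u₁ ∈ U1 𝔸) (h₂ : u₂ ∈ U1 𝔸) (h₃ : u₃ ∈ U1 𝔸) {τ : ℝ}
    (hτ₁ : ‖(u₁ : 𝔸) - 1‖ ≤ τ) (hτ₂ : ‖(u₂ : 𝔸) - 1‖ ≤ τ) (hτ₃ : ‖(u₃ : 𝔸) - 1‖ ≤ τ) :
    ‖((u₁ * u₂ * u₃⁻¹ : 𝔸ˣ) : 𝔸) - 1‖ ≤ 3 * τ := by
  have ha := norm_mul_sub_one_le ((U1 𝔸).mul_mem h₁ h₂) u₃⁻¹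
  have hb := norm_mul_sub_one_le h₁ u₂
  have hc := (norm_inv_sub_one_le h₃).trans hτ₃
  linarith

omit [NormedAlgebra ℂ 𝔸] [CompleteSpace 𝔸] in
/-- the composite transport `u₁u₂u₃⁻¹u₄⁻¹` is within `4τ` of `1`. [folklore] -/
theorem norm_w3_sub_one_le {u₁ u₂ u₃ u₄ : 𝔸ˣ} (h₁ : u₁ ∈ U1 𝔸) (h₂ : u₂ ∈ U1 𝔸) (h₃ : u₃ ∈ U1 𝔸) (h₄ : u₄ ∈ U1 𝔸) {τ : ℝ}
    (hτ₁ : ‖(u₁ : 𝔸) - 1‖ ≤ τ) (hτ₂ : ‖(u₂ : 𝔸) - 1‖ ≤ τ) (hτ₃ : ‖(u₃ : 𝔸) - 1‖ ≤ τ) (hτ₄ : ‖(u₄ : 𝔸) - 1‖ ≤ τ) :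
    ‖((u₁ * u₂ * u₃⁻¹ * u₄⁻¹ : 𝔸ˣ) : 𝔸) - 1‖ ≤ 4 * τ := by
  have ha := norm_mul_sub_one_le ((U1 𝔸).mul_mem ((U1 𝔸).mul_mem h₁ h₂) ((U1 𝔸).inv_mem h₃)) u₄⁻¹
  have hb := norm_w2_sub_one_le h₁ h₂ h₃ hτ₁ hτ₂ hτ₃
  have hc := (norm_inv_sub_one_le h₄).trans hτ₄
  linarith

end Sizes

/-! ## §2 (ℓ1): the covariant coarse curl against the flat one -/

section Perturbation

variable (L M : ℕ) [NeZero M] [Fact (1 < M)] {V₀ : Site d → Fin d → 𝔸ˣ}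
  (qb : (Fin d → ZMod M) → Site d)
  (ι4 : (Fin d → ZMod M) × {a : Fin d × Fin d // a.1 < a.2} → Fin 4 → (Fin d → ZMod M) × Fin d)
  (hι4 : ∀ x a, ι4 (x, a) = ![(x, a.1.1), (x + Pi.single a.1.1 1, a.1.2), (x + Pi.single a.1.2 1, a.1.1), (x, a.1.2)])
  (X X1 : (Fin d → ZMod M) × {a : Fin d × Fin d // a.1 < a.2} → ((Fin d → ZMod M) → Fin d → 𝔸) → ℝ)
  (hX : ∀ (y : Fin d → ZMod M) (a : {a : Fin d × Fin d // a.1 < a.2}) (B : (Fin d → ZMod M) → Fin d → 𝔸), X (y, a) B =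
    ‖B y a.1.1 + conjR (bavg L V₀ (qb y) a.1.1) (B (y + Pi.single a.1.1 1) a.1.2)
      - conjR (bavg L V₀ (qb y) a.1.1 * bavg L V₀ (qb y + (L : ℤ) • e a.1.1) a.1.2 * (bavg L V₀ (qb y + (L : ℤ) • e a.1.2) a.1.1)⁻¹)
          (B (y + Pi.single a.1.2 1) a.1.1)
      - conjR (bavg L V₀ (qb y) a.1.1 * bavg L V₀ (qb y + (L : ℤ) • e a.1.1) a.1.2 * (bavg L V₀ (qb y + (L : ℤ) • e a.1.2) a.1.1)⁻¹
          * (bavg L V₀ (qb y) a.1.2)⁻¹) (B y a.1.2)‖)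
  (hX1 : ∀ (y : Fin d → ZMod M) (a : {a : Fin d × Fin d // a.1 < a.2}) (B : (Fin d → ZMod M) → Fin d → 𝔸), X1 (y, a) B =
    ‖B y a.1.1 + B (y + Pi.single a.1.1 1) a.1.2 - B (y + Pi.single a.1.2 1) a.1.1 - B y a.1.2‖)
  (hub : ∀ q ν, bavg L V₀ q ν ∈ U1 𝔸) {τ : ℝ} (hτ : ∀ q ν, ‖(bavg L V₀ q ν : 𝔸) - 1‖ ≤ τ)

omit [NormedAlgebra ℂ 𝔸] [NormOneClass 𝔸] [CompleteSpace 𝔸] in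
/-- `|‖a + R(w₁)b − R(w₂)c − R(w₃)e‖ − ‖a + b − c − e‖| ≤ ‖R(w₁)b − b‖ + ‖R(w₂)c − c‖ + ‖R(w₃)e − e‖`. [folklore] -/
theorem abs_norm_sub_norm_le_three (a b c e b' c' e' : 𝔸) :
    |‖a + b' - c' - e'‖ - ‖a + b - c - e‖| ≤ ‖b' - b‖ + ‖c' - c‖ + ‖e' - e‖ := by
  have h := abs_norm_sub_norm_le (a + b' - c' - e') (a + b - c - e)
  have hre : a + b' - c' - e' - (a + b - c - e) = (b' - b) - (c' - c) - (e' - e) := by abel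
  rw [hre] at h
  refine h.trans ?_
  have h1 := norm_sub_le ((b' - b) - (c' - c)) (e' - e)
  have h2 := norm_sub_le (b' - b) (c' - c)
  linarith

include hX hX1 hub hτ hι4 in
omit [NeZero M] in
/-- **(ℓ1) AT ONE PLAQUETTE**: `|X_P(B) − X¹_P(B)| ≤ 8τ·Σ_{c ∈ bonds(P)} ‖B(c)‖` when every `‖V̄₀(c) − 1‖ ≤ τ` — the three rotated terms move by
`2τ`, `2·3τ`, `2·4τ` times their size (`norm_conjR_sub_self_le`); the four bonds of `P` are distinct for `1 < M`. [folklore] -/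
theorem abs_X_sub_X1_le (P : (Fin d → ZMod M) × {a : Fin d × Fin d // a.1 < a.2}) (B : (Fin d → ZMod M) → Fin d → 𝔸) :
    |X P B - X1 P B| ≤ 8 * τ * ∑ c ∈ univ.image (ι4 P), ‖B c.1 c.2‖ := by
  classical
  obtain ⟨y, a⟩ := P
  have hτ0 : 0 ≤ τ := (norm_nonneg _).trans (hτ (qb y) a.1.1)
  rw [Finset.sum_image (TorusPlaquetteIncidence.plaquetteBonds_injective ι4 hι4 (y, a)).injOn, Fin.sum_univ_four, hι4, hX, hX1]
  simp only [Matrix.cons_val_zero, Matrix.cons_val_one, Matrix.cons_val]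
  -- the three moved terms
  have h1 := norm_conjR_sub_self_le (hub (qb y) a.1.1) (hτ (qb y) a.1.1) (B (y + Pi.single a.1.1 1) a.1.2)
  have h2 := norm_conjR_sub_self_le
    ((U1 𝔸).mul_mem ((U1 𝔸).mul_mem (hub (qb y) a.1.1) (hub (qb y + (L : ℤ) • e a.1.1) a.1.2))
      ((U1 𝔸).inv_mem (hub (qb y + (L : ℤ) • e a.1.2) a.1.1)))
    (norm_w2_sub_one_le (hub (qb y) a.1.1) (hub (qb y + (L : ℤ) • e a.1.1) a.1.2) (hub (qb y + (L : ℤ) • e a.1.2) a.1.1)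
      (hτ _ _) (hτ _ _) (hτ _ _)) (B (y + Pi.single a.1.2 1) a.1.1)
  have h3 := norm_conjR_sub_self_le
    ((U1 𝔸).mul_mem ((U1 𝔸).mul_mem ((U1 𝔸).mul_mem (hub (qb y) a.1.1) (hub (qb y + (L : ℤ) • e a.1.1) a.1.2))
      ((U1 𝔸).inv_mem (hub (qb y + (L : ℤ) • e a.1.2) a.1.1))) ((U1 𝔸).inv_mem (hub (qb y) a.1.2)))
    (norm_w3_sub_one_le (hub (qb y) a.1.1) (hub (qb y + (L : ℤ) • e a.1.1) a.1.2) (hub (qb y + (L : ℤ) • e a.1.2) a.1.1)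
      (hub (qb y) a.1.2) (hτ _ _) (hτ _ _) (hτ _ _) (hτ _ _)) (B y a.1.2)
  refine (abs_norm_sub_norm_le_three _ _ _ _ _ _ _).trans ?_
  have hb2 := norm_nonneg (B (y + Pi.single a.1.1 1) a.1.2)
  have hb3 := norm_nonneg (B (y + Pi.single a.1.2 1) a.1.1)
  have hb1 := norm_nonneg (B y a.1.1)
  nlinarith

include hX hX1 hub hτ hι4 in
/-- **(ℓ1) SUMMED — THE (h2) SKELETON's `hfg` LETTER AT `k = 1`**: `Σ_P (X_P(B) − X¹_P(B))² ≤ (8τ)²·4·2(d−1)·Σ_c ‖B(c)‖²`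
(`…SqrtFormPerturbationLetters.pert_letter_of_local` BY NAME with `η := 8τ`, the sizes `c ↦ ‖B(c)‖` as the real bond vector, `a = 4`, `b = 2(d−1)`). [folklore] -/
theorem sum_sq_X_sub_X1_le (B : (Fin d → ZMod M) → Fin d → 𝔸) :
    ∑ P, (X P B - X1 P B) ^ 2 ≤ (8 * τ) ^ 2 * (4 : ℕ) * ((2 * (d - 1) : ℕ) : ℝ) * ∑ c : (Fin d → ZMod M) × Fin d, ‖B c.1 c.2‖ ^ 2 := by
  classical
  have hloc : ∀ P : (Fin d → ZMod M) × {a : Fin d × Fin d // a.1 < a.2},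
      |(fun P (_ : (Fin d → ZMod M) × Fin d → ℝ) => X P B) P (fun c => ‖B c.1 c.2‖)
        - (fun P (_ : (Fin d → ZMod M) × Fin d → ℝ) => X1 P B) P (fun c => ‖B c.1 c.2‖)|
        ≤ (8 * τ) * ∑ c ∈ univ.image (ι4 P), |(fun c : (Fin d → ZMod M) × Fin d => ‖B c.1 c.2‖) c| := fun P => by
    simp only [abs_norm]
    exact abs_X_sub_X1_le L M qb ι4 hι4 X X1 hX hX1 hub hτ P B
  have h := SqrtFormPerturbationLetters.pert_letter_of_local (fun P => univ.image (ι4 P))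
    (fun P (_ : (Fin d → ZMod M) × Fin d → ℝ) => X P B) (fun P (_ : (Fin d → ZMod M) × Fin d → ℝ) => X1 P B)
    (fun P => AveragedCurlFormSplit.card_image_four_le (ι4 P)) (fun c => TorusPlaquetteIncidence.card_plaquettes_through_bond_le ι4 hι4 c)
    (fun c : (Fin d → ZMod M) × Fin d => ‖B c.1 c.2‖) hloc
  have hs : (fun c : (Fin d → ZMod M) × Fin d => ‖B c.1 c.2‖) ⬝ᵥ (fun c => ‖B c.1 c.2‖)
      = ∑ c : (Fin d → ZMod M) × Fin d, ‖B c.1 c.2‖ ^ 2 := by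
    simp only [dotProduct, pow_two]
  rw [hs] at h
  exact h

end Perturbation

/-! ## §3 (cov)∕(iso): gauge covariance of the covariant coarse curl -/

section Gauge

variable (L M : ℕ) [NeZero M] {V₀ : Site d → Fin d → 𝔸ˣ}
  (qb : (Fin d → ZMod M) → Site d) (hqb : ∀ y i, qb y i = (L : ℤ) * (((y i).val : ℕ) : ℤ))
  (X X' : (Fin d → ZMod M) × {a : Fin d × Fin d // a.1 < a.2} → ((Fin d → ZMod M) → Fin d → 𝔸) → ℝ)
  (hX : ∀ (y : Fin d → ZMod M) (a : {a : Fin d × Fin d // a.1 < a.2}) (B : (Fin d → ZMod M) → Fin d → 𝔸), X (y, a) B =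
    ‖B y a.1.1 + conjR (bavg L V₀ (qb y) a.1.1) (B (y + Pi.single a.1.1 1) a.1.2)
      - conjR (bavg L V₀ (qb y) a.1.1 * bavg L V₀ (qb y + (L : ℤ) • e a.1.1) a.1.2 * (bavg L V₀ (qb y + (L : ℤ) • e a.1.2) a.1.1)⁻¹)
          (B (y + Pi.single a.1.2 1) a.1.1)
      - conjR (bavg L V₀ (qb y) a.1.1 * bavg L V₀ (qb y + (L : ℤ) • e a.1.1) a.1.2 * (bavg L V₀ (qb y + (L : ℤ) • e a.1.2) a.1.1)⁻¹
          * (bavg L V₀ (qb y) a.1.2)⁻¹) (B y a.1.2)‖)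
  (g : Site d → 𝔸ˣ) (hg : ∀ x, g x ∈ U1 𝔸) (hgper : IsPeriodic (L * M) g)
  (hX' : ∀ (y : Fin d → ZMod M) (a : {a : Fin d × Fin d // a.1 < a.2}) (B : (Fin d → ZMod M) → Fin d → 𝔸), X' (y, a) B =
    ‖B y a.1.1 + conjR (bavg L (gaugeAct g V₀) (qb y) a.1.1) (B (y + Pi.single a.1.1 1) a.1.2)
      - conjR (bavg L (gaugeAct g V₀) (qb y) a.1.1 * bavg L (gaugeAct g V₀) (qb y + (L : ℤ) • e a.1.1) a.1.2
          * (bavg L (gaugeAct g V₀) (qb y + (L : ℤ) • e a.1.2) a.1.1)⁻¹) (B (y + Pi.single a.1.2 1) a.1.1)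
      - conjR (bavg L (gaugeAct g V₀) (qb y) a.1.1 * bavg L (gaugeAct g V₀) (qb y + (L : ℤ) • e a.1.1) a.1.2
          * (bavg L (gaugeAct g V₀) (qb y + (L : ℤ) • e a.1.2) a.1.1)⁻¹ * (bavg L (gaugeAct g V₀) (qb y) a.1.2)⁻¹) (B y a.1.2)‖)
  (hW1 : ∀ (q : Site d) (κ : Fin d) (r : Fin d → Fin L), ‖((Wcx L V₀ q κ (boxVec L r) : 𝔸ˣ) : 𝔸) - 1‖ < 1)

include hX hg hX' hW1 in
omit [NeZero M] in
/-- **(cov)∕(iso) AT ONE PLAQUETTE, CORE FORM**: if the gauge function reads the same at the torus neighbours `qb(y + e_κ)`, `qb(y + e_μ)` and at the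
`ℤ^d` neighbours `qb y + L e_κ`, `qb y + L e_μ` of the base point (periodic `g`: `X_gaugeAct_eq`; or no wrap at `y`: `X_gaugeAct_eq_of_noWrap`), then
`X'_{(y,κ<μ)}((y,ν) ↦ R(g(qb y))B(y,ν)) = X_{(y,κ<μ)}(B)`. [folklore] -/
theorem X_gaugeAct_eq_of_eq (y : Fin d → ZMod M) (a : {a : Fin d × Fin d // a.1 < a.2}) (B : (Fin d → ZMod M) → Fin d → 𝔸)
    (hgκ : g (qb (y + Pi.single a.1.1 1)) = g (qb y + (L : ℤ) • e a.1.1))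
    (hgμ : g (qb (y + Pi.single a.1.2 1)) = g (qb y + (L : ℤ) • e a.1.2)) :
    X' (y, a) (fun y ν => conjR (g (qb y)) (B y ν)) = X (y, a) B := by
  rw [hX', hX]
  -- the transformed transports (11)
  have hb : ∀ (q : Site d) (κ : Fin d), bavg L (gaugeAct g V₀) q κ = g q * bavg L V₀ q κ * (g (q + (L : ℤ) • e κ))⁻¹ :=
    fun q κ => bavg_gaugeAct L hg V₀ q κ (hW1 q κ)
  simp only [hb, hgκ, hgμ]
  -- name the transports
  set g₀ := g (qb y) with hg₀
  set gκ := g (qb y + (L : ℤ) • e a.1.1)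
  set gμ := g (qb y + (L : ℤ) • e a.1.2)
  set gκμ := g (qb y + (L : ℤ) • e a.1.1 + (L : ℤ) • e a.1.2)
  set u₁ := bavg L V₀ (qb y) a.1.1
  set u₂ := bavg L V₀ (qb y + (L : ℤ) • e a.1.1) a.1.2
  set u₃ := bavg L V₀ (qb y + (L : ℤ) • e a.1.2) a.1.1
  set u₄ := bavg L V₀ (qb y) a.1.2
  have hcomm : qb y + (L : ℤ) • e a.1.2 + (L : ℤ) • e a.1.1 = qb y + (L : ℤ) • e a.1.1 + (L : ℤ) • e a.1.2 := add_right_comm _ _ _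
  rw [hcomm]
  -- the composite transports conjugate by `g₀`
  have hw1 : g₀ * u₁ * gκ⁻¹ * gκ = g₀ * u₁ := by group
  have hw2 : g₀ * u₁ * gκ⁻¹ * (gκ * u₂ * gκμ⁻¹) * (gμ * u₃ * gκμ⁻¹)⁻¹ * gμ = g₀ * (u₁ * u₂ * u₃⁻¹) := by group
  have hw3 : g₀ * u₁ * gκ⁻¹ * (gκ * u₂ * gκμ⁻¹) * (gμ * u₃ * gκμ⁻¹)⁻¹ * (g₀ * u₄ * gμ⁻¹)⁻¹ * g₀ = g₀ * (u₁ * u₂ * u₃⁻¹ * u₄⁻¹) := by group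
  have e2 : conjR (g₀ * u₁ * gκ⁻¹) (conjR gκ (B (y + Pi.single a.1.1 1) a.1.2)) = conjR g₀ (conjR u₁ (B (y + Pi.single a.1.1 1) a.1.2)) := by
    rw [← conjR_mul_left, hw1, conjR_mul_left]
  have e3 : conjR (g₀ * u₁ * gκ⁻¹ * (gκ * u₂ * gκμ⁻¹) * (gμ * u₃ * gκμ⁻¹)⁻¹) (conjR gμ (B (y + Pi.single a.1.2 1) a.1.1))
      = conjR g₀ (conjR (u₁ * u₂ * u₃⁻¹) (B (y + Pi.single a.1.2 1) a.1.1)) := by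
    rw [← conjR_mul_left, hw2, conjR_mul_left]
  have e4 : conjR (g₀ * u₁ * gκ⁻¹ * (gκ * u₂ * gκμ⁻¹) * (gμ * u₃ * gκμ⁻¹)⁻¹ * (g₀ * u₄ * gμ⁻¹)⁻¹) (conjR g₀ (B y a.1.2))
      = conjR g₀ (conjR (u₁ * u₂ * u₃⁻¹ * u₄⁻¹) (B y a.1.2)) := by
    rw [← conjR_mul_left, hw3, conjR_mul_left]
  rw [e2, e3, e4, ← conjR_add, ← conjR_sub, ← conjR_sub, B8Ineq132.norm_conjR (hg (qb y))]

include hqb hX hg hgper hX' hW1 in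
/-- **(cov)∕(iso) AT ONE STEP, PERIODIC GAUGE FUNCTION**: the curl functional of the gauge-transformed background `V₀^g` at the transformed form
`(y,ν) ↦ R(g(qb y))B(y,ν)` equals the curl functional of `V₀` at `B` — `(11)` for `V̄₀` (`bavg_gaugeAct`), the wrap lemma for the periodic `g`, and
`‖R(g)Z‖ = ‖Z‖`. [folklore] -/
theorem X_gaugeAct_eq (P : (Fin d → ZMod M) × {a : Fin d × Fin d // a.1 < a.2}) (B : (Fin d → ZMod M) → Fin d → 𝔸) :
    X' P (fun y ν => conjR (g (qb y)) (B y ν)) = X P B := by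
  obtain ⟨y, a⟩ := P
  exact X_gaugeAct_eq_of_eq L M qb X X' hX g hg hX' hW1 y a B
    (OneStepAveragePeriodicity.apply_qb_add_single L M qb hqb hgper y a.1.1)
    (OneStepAveragePeriodicity.apply_qb_add_single L M qb hqb hgper y a.1.2)

include hqb in
omit [NormedAlgebra ℂ 𝔸] [NormOneClass 𝔸] [CompleteSpace 𝔸] [NormedRing 𝔸] in
/-- no wrap at `y` in direction `κ` (`y_κ + 1 < M`): the torus neighbour IS the `ℤ^d` neighbour, `qb(y + e_κ) = qb y + L e_κ`. [folklore] -/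
theorem qb_add_single_of_noWrap (y : Fin d → ZMod M) (κ : Fin d) (hκ : (y κ).val + 1 < M) :
    qb (y + Pi.single κ 1) = qb y + (L : ℤ) • e κ := by
  rw [OneStepAveragePeriodicity.qb_add_single L M qb hqb y κ, Nat.div_eq_of_lt hκ]
  have h0 : (fun i : Fin d => if i = κ then -(((0 : ℕ) : ℤ)) else 0) = 0 := by
    funext i; split_ifs <;> simp
  rw [h0, smul_zero, add_zero]

include hqb hX hg hX' hW1 in
/-- **(cov)∕(iso) AT AN INTERIOR PLAQUETTE, ANY GAUGE FUNCTION** (no wrap at `y` in the two directions of `P`: `y_κ + 1 < M`, `y_μ + 1 < M` — the case of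
a local gauge on a cube not meeting the seam of the fundamental domain, e.g. the axial gauge of reading R-V): the same identity, no periodicity asked of `g`.
[folklore] -/
theorem X_gaugeAct_eq_of_noWrap (y : Fin d → ZMod M) (a : {a : Fin d × Fin d // a.1 < a.2}) (B : (Fin d → ZMod M) → Fin d → 𝔸)
    (hκ : (y a.1.1).val + 1 < M) (hμ : (y a.1.2).val + 1 < M) :
    X' (y, a) (fun y ν => conjR (g (qb y)) (B y ν)) = X (y, a) B :=
  X_gaugeAct_eq_of_eq L M qb X X' hX g hg hX' hW1 y a B (by rw [qb_add_single_of_noWrap L M qb hqb y a.1.1 hκ])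
    (by rw [qb_add_single_of_noWrap L M qb hqb y a.1.2 hμ])

/-- **THE BLOCK LOOPS ARE IN THE LOGARITHM's DOMAIN UNDER (44)**: `‖V₀(Γ_{c,x})V₀(c)⁻¹ − 1‖ < 1` when `‖V₀(∂p) − 1‖ ≤ α₀` and `512(d+1)(d+4)L²α₀ ≤ 1`
(`B7Prop2Explicit.norm_Wcx_sub_one_le`: `≤ 1∕32`) — the hypothesis `hW1` of `X_gaugeAct_eq` in the regime of `…OneStepCurlFormDisplay`. [folklore] -/
theorem Wcx_sub_one_lt_one (hL : 1 ≤ L) (hV₀ : ∀ x κ, V₀ x κ ∈ U1 𝔸) {α₀ : ℝ} (hα₀ : 0 ≤ α₀)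
    (hsmall : 512 * (d + 1) * (d + 4) * (L : ℝ) ^ 2 * α₀ ≤ 1)
    (h44 : ∀ (x : Site d) (κ κ' : Fin d), κ ≠ κ' → ‖((hol V₀ x (plaqWord κ κ') : 𝔸ˣ) : 𝔸) - 1‖ ≤ α₀)
    (q : Site d) (κ : Fin d) (r : Fin d → Fin L) : ‖((Wcx L V₀ q κ (boxVec L r) : 𝔸ˣ) : 𝔸) - 1‖ < 1 := by
  have hd0 : (0 : ℝ) ≤ (d + 1) * (d + 4) * (L : ℝ) ^ 2 * α₀ := by positivity
  exact (B7Prop2Explicit.norm_Wcx_sub_one_le L hL V₀ hV₀ hα₀ hsmall h44 q κ r).trans_lt (by nlinarith)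

end Gauge

end Summit.QuantumFields.BalabanUV.T4Continuum.NE7b.CoarseCurlTransportLetters

end
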